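/-
COR-CM (cells pub-hodgecm / pub-hodgecm2, stage 2 of the Hodge ladder) — TRANSPOSITION SURGE, item (vi) sub-binder S2 / (vi-2)
`supply`: the ASSEMBLY AT THE APPENDIX-C DATUM ALONG `e ι₁` (pin-3 = prover-pub-hodgecm2-pin-3-0, the integrator; pin-1 gen 2's hand-over
pub-hodgecm2/INBOX 2026-08-21T19:58:35Z: «the END display at (P5, σ/e := ῑ₁) can be assembled from the two `…_along` files now»).
Composes BY NAME pin-2's `Model.faceSupply_of_thm418AsPrinted_pinned_isog_along` (`Transposition/Item6PinMatchAlong.lean`, p300221 ✔)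
and pin-1's `Model.pinReach_of_treeCofan_of_alb_along` / `Model.pinReach_of_componentPinC_of_unif_of_alb_along`
(`Transposition/Item6PinReachAlong.lean`, p301648 ✔) with tr-prover-6's `Model.hc_cm_of_supply_of_dictionary_of_eq` (`Item6HoldsRec.lean`).
Theorems only: no definition, no instance, no named fact, no `variable`, nothing asserted, no proof holes; nothing landed is edited
or restated.  FRAMING: HC_CM is NOT proved.
-/
import Summits.HodgeConjecture.CorCM.B01.Transposition.Item6PinReachAlong
import Summits.HodgeConjecture.CorCM.B01.Transposition.Item6PinMatchAlong
import Summits.HodgeConjecture.CorCM.B01.Transposition.Item6HoldsRec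
import HarnessLib

/-!
# Item (vi) S2 / HC_CM from [Liu 2021, Thm. 4.18] AS PRINTED at the APPENDIX-C DATUM, pinned ALONG `e ι₁` — the team-facing END display

The E-rational assembly of record (`Transposition/Item6SupplyPinnedAssembly.lean`, p299635 ✔, `Model.hc_cm_of_thm418AsPrinted_pinnedE_isog`)
is stated for a FREE datum family `D` and free carriers `Aμ₀`/`AK` with the tie `homE`/`hE`.  Here the datum IS Liu's: `D F ι₁ V Φ :=
AppendixC.toThm418Data (C F ι₁ V Φ) (R F ι₁ V Φ)` (liuC-typer-4's `AppendixC/Glue.lean`, p293186 ✔: `P5` = the Prop. C.5 datum of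
[Liu2021] App. C l. 4624–4637, `C : Sec42Data` = §4.2 l. 2053–2074 with `A_K := Alb_{X_K}` over `E`, `R : Thm418Rest C` = the rest of
Thm. 4.18's data with «`A_μ` an abelian variety over `E`», Def. 4.5 (2) l. 1944; `HomK K D_μ = ℚ ⊗ Hom_E(A_{levelOf K}, A_μ D_μ)` by `rfl`,
so `homE`/`hE` DISAPPEAR), and the pin is `A_μ ⊗_{E,e ι₁} ℂ := (letI := (e F ι₁).toAlgebra; ((R F ι₁ V Φ).Aμ D_μ).baseChange ℂ)` along
the consumer's embedding family `e` (package P1: `e := fun _ ι₁ => ι₁`; package P2′: `e := fun _ ι₁ => (starRingEnd ℂ).toRingHom.comp ι₁`,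
pin-1 `Item6PinReachAlong.lean` module docstring; pin-2 reads the CM side along `σ := e ι₁`).  BINDERS of the END display §3
(each face-guarded `IsGalois ℚ F → 6 ≤ [F:ℚ] → ι₁ ∈ Φ.1`; owners in brackets):
* carriers `e`, `P5`, `iso`, `C`, `R` (the consumer's instantiation of Liu's objects; TEAM hComp's `HonestP5Of` / record system);
* `hLiu` — THE CITE, [Liu2021] Thm. 4.18 EXACTLY AS PRINTED (l. 2232–2245) at `toThm418Data (C …) (R …)`; `hObj` (Prop. 4.6 (1) l. 1969,
  record `Prop46AsPrinted` p295557), `hChi`/`hirr`/`hsm` (Def. 4.11 l. 2090–2096, record `Def411AsPrinted` p295530);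
* `hμσ` — the CHOICE `Φ_μ = Φ^{*e ι₁}` [pin-2]; `hCMisogσ` — Def. 4.5 (2) (rational `i_μ`, l. 1947; first bullet l. 1947–1949) + Def. 4.3 (2)
  l. 1919 read UP TO ISOGENY along `e ι₁` on `A_μ ⊗_{E,e ι₁} ℂ` [pin-2 / TEAM hCMisogE];
* `hTree` — LIU'S isometry-type Shimura variety `Sh(G(τ), h_{V(τ),e ι₁})_{fix τ K}` (carrier `(P5 …).Sh τ (e ι₁)`, App. C Rem. C.2 / l. 4599)
  base-changed to `ℂ` is a finite COPRODUCT OF TREE SURFACES `P_{Γ_c}(V)` below some open compact `Ksm` ([Deligne 1979 §2.1.2 +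
  2.2.1–2.2.5]; pin-1 §5) [pin-1 / TEAM hComp `HUnifHolds`]; `hAlb` — `Alb_{X_K} ⊗_{E,e ι₁} ℂ = ∏_c Alb` for every finite coproduct
  decomposition into smooth projective surfaces ([Liu2021] §2.1 Prop. l. 1185–1200, Def. 2.3, Lemma 2.2) [pin-1 / TEAM hComp `HAlbHolds`];
* `hD` — items (iii)+(v) at `Θ := Uiso`, VERBATIM from `Model.hc_cm_of_supply_of_dictionary_of_eq` (`Item6HoldsRec.lean`:211–226) [ROW HD].
§1 `Model.faceSupply_of_thm418AsPrinted_glue_treeCofan_along` — B01-S from {hTree, hAlb} + the Liu side; §2 `Model.faceSupply_of_thm418AsPrinted_glue_unif_along`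
— the same from pin-1's {hUnif, hAlb} (pieces with explicit ball data); §3 `Model.hc_cm_of_thm418AsPrinted_glue_treeCofan_along (U) (hU := rfl) … (hD) :
HC_CM` — THE TEAM-FACING END DISPLAY: every binder a consumer carrier, the as-printed cite, a printed-elsewhere carrier, or ONE of the
named readings {hμσ (choice), hCMisogσ, hTree, hAlb, hD} — when TEAM hComp lands `HUnifHolds`/`HAlbHolds` and TEAM hCMisogE lands the
Def. 4.5 reading at `σ = e ι₁`, they drop BY NAME here.  STRENGTH: ⟹ B01-S; class O (object pin: the Liu-side binders at this datum force
`F`-models — x2 g4 EPIN-T1); no «↔ B01-S» is possible or claimed.  HC_CM is NOT proved; `hCMisogσ`, `hTree`/`hUnif`, `hAlb`, `hD` are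
NOT inhabited here.

References: Y. Liu, arXiv:2102.11518 = Camb. J. Math. 9 (2021) (`FJcycle.tex` md5 6db49a74122d): §2.1 l. 1185–1211, Def. 4.3 (2) l. 1919,
Def. 4.5 l. 1936–1964, Prop. 4.6 (1) l. 1969, §4.2 l. 2053–2076, Def. 4.11 l. 2083–2097, Thm. 4.18 l. 2232–2245, App. C l. 4583–4637, 4656.
P. Deligne, *Variétés de Shimura* (Corvallis 1979) §2.1.2, 2.2.1–2.2.5.  G. Shimura, *Abelian Varieties with CM* (1998) §6.2 Thm. 3, §8.3 Prop. 28.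
-/

noncomputable section

open scoped TensorProduct InnerProductSpace

namespace Summit.HodgeConjecture.CorCM.Model

open CategoryTheory CategoryTheory.Limits AlgebraicGeometry NumberField
open Literature.AlgebraicGeometry.Motives
open Literature.AlgebraicGeometry.Motives.HodgeStructure (conj)
open Literature.AlgebraicGeometry.HodgeTheory
open Literature.AlgebraicGeometry.ShimuraVarieties
open Literature.AlgebraicGeometry.ComplexMultiplication (IsCMTypeRealisation)
open Literature.NumberTheory.ComplexMultiplication
open Literature.NumberTheory.Automorphic
open Literature.NumberTheory.Automorphic.IdeleClassGroup
open Literature.NumberTheory.Automorphic.PicardCM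
open Literature.NumberTheory.Automorphic.Liu2021
open Literature.NumberTheory.Automorphic.Liu2021.AppendixC

/-! ## §1  B01-S at the Appendix-C datum along `e ι₁` from {hTree, hAlb} (TEAM hComp's target shape) + the Liu side -/

/-- **B01-S from [Liu 2021, Thm. 4.18] AS PRINTED at the APPENDIX-C DATUM, pin `A_μ ⊗_{E,e ι₁} ℂ`, Shimura side from a cofan by TREE
surfaces** (`U = picardCMUniverse hHD hI h₁ h₃`).  = pin-2's `faceSupply_of_thm418AsPrinted_pinned_isog_along` at `D := toThm418Data (C …) (R …)`,
`σ := e ι₁`, `Aμ := A_μ ⊗_{E,e ι₁} ℂ`, with `hReach :=` pin-1's `pinReach_of_treeCofan_of_alb_along` (binders `hTree`, `hAlb`).  Binder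
sources: module docstring.  HC_CM is NOT proved; `hCMisogσ`, `hTree`, `hAlb` are not inhabited here.
[cite: Liu2021, Thm. 4.18 (FJcycle.tex l. 2232–2245), Def. 4.5 (2) (l. 1944–1951), §4.2 l. 2060–2066 and Prop. C.5 (l. 4627–4637)]
[cite: Deligne1979ShimuraVarieties, §2.1.2] -/
theorem faceSupply_of_thm418AsPrinted_glue_treeCofan_along
    (hHD : exists_isReal_hodgeModel) (hI : hodgePQ_independent_of_hodgeModel)
    (h₁ : BallQuotientUniformised) (h₃ : CMAbelianVarietyRealised)
    (e : ∀ (F : CMField), (F →+* ℂ) → (F →+* ℂ))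
    (P5 : ∀ (F : CMField) (ι₁ : F →+* ℂ) (_ : HermSpace3 F ι₁) (_ : CMType F), PropC5Data (maximalRealSubfield F) F)
    (iso : ∀ (F : CMField) (ι₁ : F →+* ℂ) (_ : HermSpace3 F ι₁) (_ : CMType F), ℕ → Prop)
    (C : ∀ (F : CMField) (ι₁ : F →+* ℂ) (V : HermSpace3 F ι₁) (Φ : CMType F), Sec42Data (P5 F ι₁ V Φ) (iso F ι₁ V Φ))
    (R : ∀ (F : CMField) (ι₁ : F →+* ℂ) (V : HermSpace3 F ι₁) (Φ : CMType F), Thm418Rest (C F ι₁ V Φ))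
    (hLiu : ∀ (F : CMField), IsGalois ℚ F → 6 ≤ Module.finrank ℚ F → ∀ (Φ : CMType F) (ι₁ : F →+* ℂ), ι₁ ∈ Φ.1 →
      ∀ V : HermSpace3 F ι₁, Thm418AsPrinted (toThm418Data (C F ι₁ V Φ) (R F ι₁ V Φ)))
    (hObj : ∀ (F : CMField), IsGalois ℚ F → 6 ≤ Module.finrank ℚ F → ∀ (Φ : CMType F) (ι₁ : F →+* ℂ), ι₁ ∈ Φ.1 →
      ∀ V : HermSpace3 F ι₁, Nonempty (toThm418Data (C F ι₁ V Φ) (R F ι₁ V Φ)).Obj)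
    (hChi : ∀ (F : CMField), IsGalois ℚ F → 6 ≤ Module.finrank ℚ F → ∀ (Φ : CMType F) (ι₁ : F →+* ℂ), ι₁ ∈ Φ.1 →
      ∀ V : HermSpace3 F ι₁, Nonempty (toThm418Data (C F ι₁ V Φ) (R F ι₁ V Φ)).Chi)
    (hirr : ∀ (F : CMField), IsGalois ℚ F → 6 ≤ Module.finrank ℚ F → ∀ (Φ : CMType F) (ι₁ : F →+* ℂ), ι₁ ∈ Φ.1 →
      ∀ (V : HermSpace3 F ι₁) (i : (toThm418Data (C F ι₁ V Φ) (R F ι₁ V Φ)).AdmIndex), ((toThm418Data (C F ι₁ V Φ) (R F ι₁ V Φ)).rhoAt i).IsIrreducible)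
    (hsm : ∀ (F : CMField), IsGalois ℚ F → 6 ≤ Module.finrank ℚ F → ∀ (Φ : CMType F) (ι₁ : F →+* ℂ), ι₁ ∈ Φ.1 →
      ∀ (V : HermSpace3 F ι₁) (i : (toThm418Data (C F ι₁ V Φ) (R F ι₁ V Φ)).AdmIndex) (v : (toThm418Data (C F ι₁ V Φ) (R F ι₁ V Φ)).omegaAt i),
        ∃ S : Subgroup (toThm418Data (C F ι₁ V Φ) (R F ι₁ V Φ)).G, IsOpen (S : Set (toThm418Data (C F ι₁ V Φ) (R F ι₁ V Φ)).G) ∧ ∀ k ∈ S, (toThm418Data (C F ι₁ V Φ) (R F ι₁ V Φ)).rhoAt i k v = v)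
    (hμσ : ∀ (F : CMField), IsGalois ℚ F → 6 ≤ Module.finrank ℚ F → ∀ (Φ : CMType F) (ι₁ : F →+* ℂ), ι₁ ∈ Φ.1 →
      ∀ (V : HermSpace3 F ι₁) (g : F ≃ₐ[ℚ] F),
        (e F ι₁).comp (g : F →+* F) ∈ (toThm418Data (C F ι₁ V Φ) (R F ι₁ V Φ)).cmType.1 ↔ (e F ι₁).comp (g.symm : F →+* F) ∈ Φ.1)
    (hCMisogσ : ∀ (F : CMField) [IsGalois ℚ F], 6 ≤ Module.finrank ℚ F → ∀ (Φ : CMType F) (ι₁ : F →+* ℂ), ι₁ ∈ Φ.1 →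
      ∀ (V : HermSpace3 F ι₁) (Dμ : (toThm418Data (C F ι₁ V Φ) (R F ι₁ V Φ)).Obj),
        haveI := (toThm418Data (C F ι₁ V Φ) (R F ι₁ V Φ)).isConjugateSymplectic.numberField_muAlgValueField
        ∀ incl : reflexField ℚ F (algValuedIn (e F ι₁) (toThm418Data (C F ι₁ V Φ) (R F ι₁ V Φ)).cmType.1) →+* muAlgValueField F (toThm418Data (C F ι₁ V Φ) (R F ι₁ V Φ)).μ,
          (∀ k : reflexField ℚ F (algValuedIn (e F ι₁) (toThm418Data (C F ι₁ V Φ) (R F ι₁ V Φ)).cmType.1),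
            ((incl k : muAlgValueField F (toThm418Data (C F ι₁ V Φ) (R F ι₁ V Φ)).μ) : ℂ) = e F ι₁ k) →
          ∃ (B : AbelianVariety ℂ) (g : (letI := (e F ι₁).toAlgebra; ((R F ι₁ V Φ).Aμ Dμ).baseChange ℂ) ⟶ B), AbelianVariety.IsIsogeny g ∧
            ∃ (ιB : 𝓞 (muAlgValueField F (toThm418Data (C F ι₁ V Φ) (R F ι₁ V Φ)).μ) →+* End B)
              (θB : muAlgValueField F (toThm418Data (C F ι₁ V Φ) (R F ι₁ V Φ)).μ →+* Module.End ℂ (complexBetti B.X 1)),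
              IsCMTypeRealisation (inducedCMType incl (reflexCMType (e F ι₁) (toThm418Data (C F ι₁ V Φ) (R F ι₁ V Φ)).cmType (AlgHom.id ℚ F))) B ιB θB)
    (hTree : ∀ (F : CMField), IsGalois ℚ F → 6 ≤ Module.finrank ℚ F → ∀ (Φ : CMType F) (ι₁ : F →+* ℂ), ι₁ ∈ Φ.1 →
      ∀ (V : HermSpace3 F ι₁) (τ : maximalRealSubfield F →+* ℝ), C5.IsAbove τ (e F ι₁) →
        ∃ Ksm : Subgroup (P5 F ι₁ V Φ).G, IsOpenCompact Ksm ∧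
          ∀ K : C5.OpenCompactSubgroup (P5 F ι₁ V Φ).G, K.1 ≤ Ksm →
            ∃ (Cset : Type) (_ : Fintype Cset) (Γ : Cset → Level V)
              (inj : ∀ c, Var.scheme (ballQuotientUniformisedDatum_of h₁) h₃ (.pms (pmsCode F ι₁ V (Γ c))) ⟶
                (baseChangeHom (e F ι₁).fieldRange.subtype).obj
                  (((P5 F ι₁ V Φ).Sh τ (e F ι₁)).obj (C5.OpenCompactSubgroup.transport ((P5 F ι₁ V Φ).fix τ) K))),
              Nonempty (IsColimit (Cofan.mk _ inj)))
    (hAlb : ∀ (F : CMField), IsGalois ℚ F → 6 ≤ Module.finrank ℚ F → ∀ (Φ : CMType F) (ι₁ : F →+* ℂ), ι₁ ∈ Φ.1 →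
      ∀ (V : HermSpace3 F ι₁) (K' : C5.SmallLevel (C F ι₁ V Φ).S.K₀) (Cset : Type) (_ : Fintype Cset) (X : Cset → SchemeOver ℂ)
        (inj : ∀ c, X c ⟶ (baseChangeHom (e F ι₁)).obj ((C F ι₁ V Φ).X K')),
        (∀ c, IsSmoothProjective 2 (X c)) → Nonempty (IsColimit (Cofan.mk _ inj)) →
          ∃ (𝒥 : ∀ c, Jacobian (X c)) (π : ∀ c, (letI := (e F ι₁).toAlgebra; ((C F ι₁ V Φ).A K').baseChange ℂ) ⟶ (𝒥 c).J),
            Nonempty (IsLimit (Fan.mk (letI := (e F ι₁).toAlgebra; ((C F ι₁ V Φ).A K').baseChange ℂ) π))) :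
    (picardCMUniverse hHD hI h₁ h₃).FaceSupply :=
  faceSupply_of_thm418AsPrinted_pinned_isog_along hHD hI h₁ h₃
    (fun F ι₁ V Φ => toThm418Data (C F ι₁ V Φ) (R F ι₁ V Φ)) (fun F ι₁ _ _ => e F ι₁)
    (fun F ι₁ V Φ Dμ => letI := (e F ι₁).toAlgebra; ((R F ι₁ V Φ).Aμ Dμ).baseChange ℂ)
    hLiu hObj hChi hirr hsm hμσ (fun F _ h6 Φ ι₁ hι V Dμ => hCMisogσ F h6 Φ ι₁ hι V Dμ)
    (pinReach_of_treeCofan_of_alb_along h₁ h₃ e P5 iso C R hTree hAlb)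

/-! ## §2  The same from pin-1's {hUnif, hAlb} (pieces with explicit ball data) -/

/-- **B01-S from [Liu 2021, Thm. 4.18] AS PRINTED at the APPENDIX-C DATUM, pin `A_μ ⊗_{E,e ι₁} ℂ`, Shimura side from {`hUnif`, `hAlb`}**
(`hUnif`: [Deligne 1979 §2.1.2] on Liu's carrier `(P5 …).Sh τ (e ι₁)` — below some open compact `Ksm`, `Sh(G(τ), h_{V(τ),e ι₁})_K ⊗ ℂ` is a finite
coproduct of complex surfaces each ball-uniformised by the tree's tautological ball of `V^{ι₁}` with group `ι₁(Γ_c)`; `hAlb` as in §1);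
`hReach :=` pin-1's `pinReach_of_componentPinC_of_unif_of_alb_along`.  HC_CM is NOT proved; `hCMisogσ`, `hUnif`, `hAlb` are not inhabited here.
[cite: Liu2021, Thm. 4.18 (FJcycle.tex l. 2232–2245), Def. 4.5 (2) (l. 1944–1951), §4.2 l. 2060–2066 and Prop. C.5 (l. 4627–4637)]
[cite: Deligne1979ShimuraVarieties, §2.1.2] -/
theorem faceSupply_of_thm418AsPrinted_glue_unif_along
    (hHD : exists_isReal_hodgeModel) (hI : hodgePQ_independent_of_hodgeModel)
    (h₁ : BallQuotientUniformised) (h₃ : CMAbelianVarietyRealised)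
    (e : ∀ (F : CMField), (F →+* ℂ) → (F →+* ℂ))
    (P5 : ∀ (F : CMField) (ι₁ : F →+* ℂ) (_ : HermSpace3 F ι₁) (_ : CMType F), PropC5Data (maximalRealSubfield F) F)
    (iso : ∀ (F : CMField) (ι₁ : F →+* ℂ) (_ : HermSpace3 F ι₁) (_ : CMType F), ℕ → Prop)
    (C : ∀ (F : CMField) (ι₁ : F →+* ℂ) (V : HermSpace3 F ι₁) (Φ : CMType F), Sec42Data (P5 F ι₁ V Φ) (iso F ι₁ V Φ))
    (R : ∀ (F : CMField) (ι₁ : F →+* ℂ) (V : HermSpace3 F ι₁) (Φ : CMType F), Thm418Rest (C F ι₁ V Φ))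
    (hLiu : ∀ (F : CMField), IsGalois ℚ F → 6 ≤ Module.finrank ℚ F → ∀ (Φ : CMType F) (ι₁ : F →+* ℂ), ι₁ ∈ Φ.1 →
      ∀ V : HermSpace3 F ι₁, Thm418AsPrinted (toThm418Data (C F ι₁ V Φ) (R F ι₁ V Φ)))
    (hObj : ∀ (F : CMField), IsGalois ℚ F → 6 ≤ Module.finrank ℚ F → ∀ (Φ : CMType F) (ι₁ : F →+* ℂ), ι₁ ∈ Φ.1 →
      ∀ V : HermSpace3 F ι₁, Nonempty (toThm418Data (C F ι₁ V Φ) (R F ι₁ V Φ)).Obj)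
    (hChi : ∀ (F : CMField), IsGalois ℚ F → 6 ≤ Module.finrank ℚ F → ∀ (Φ : CMType F) (ι₁ : F →+* ℂ), ι₁ ∈ Φ.1 →
      ∀ V : HermSpace3 F ι₁, Nonempty (toThm418Data (C F ι₁ V Φ) (R F ι₁ V Φ)).Chi)
    (hirr : ∀ (F : CMField), IsGalois ℚ F → 6 ≤ Module.finrank ℚ F → ∀ (Φ : CMType F) (ι₁ : F →+* ℂ), ι₁ ∈ Φ.1 →
      ∀ (V : HermSpace3 F ι₁) (i : (toThm418Data (C F ι₁ V Φ) (R F ι₁ V Φ)).AdmIndex), ((toThm418Data (C F ι₁ V Φ) (R F ι₁ V Φ)).rhoAt i).IsIrreducible)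
    (hsm : ∀ (F : CMField), IsGalois ℚ F → 6 ≤ Module.finrank ℚ F → ∀ (Φ : CMType F) (ι₁ : F →+* ℂ), ι₁ ∈ Φ.1 →
      ∀ (V : HermSpace3 F ι₁) (i : (toThm418Data (C F ι₁ V Φ) (R F ι₁ V Φ)).AdmIndex) (v : (toThm418Data (C F ι₁ V Φ) (R F ι₁ V Φ)).omegaAt i),
        ∃ S : Subgroup (toThm418Data (C F ι₁ V Φ) (R F ι₁ V Φ)).G, IsOpen (S : Set (toThm418Data (C F ι₁ V Φ) (R F ι₁ V Φ)).G) ∧ ∀ k ∈ S, (toThm418Data (C F ι₁ V Φ) (R F ι₁ V Φ)).rhoAt i k v = v)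
    (hμσ : ∀ (F : CMField), IsGalois ℚ F → 6 ≤ Module.finrank ℚ F → ∀ (Φ : CMType F) (ι₁ : F →+* ℂ), ι₁ ∈ Φ.1 →
      ∀ (V : HermSpace3 F ι₁) (g : F ≃ₐ[ℚ] F),
        (e F ι₁).comp (g : F →+* F) ∈ (toThm418Data (C F ι₁ V Φ) (R F ι₁ V Φ)).cmType.1 ↔ (e F ι₁).comp (g.symm : F →+* F) ∈ Φ.1)
    (hCMisogσ : ∀ (F : CMField) [IsGalois ℚ F], 6 ≤ Module.finrank ℚ F → ∀ (Φ : CMType F) (ι₁ : F →+* ℂ), ι₁ ∈ Φ.1 →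
      ∀ (V : HermSpace3 F ι₁) (Dμ : (toThm418Data (C F ι₁ V Φ) (R F ι₁ V Φ)).Obj),
        haveI := (toThm418Data (C F ι₁ V Φ) (R F ι₁ V Φ)).isConjugateSymplectic.numberField_muAlgValueField
        ∀ incl : reflexField ℚ F (algValuedIn (e F ι₁) (toThm418Data (C F ι₁ V Φ) (R F ι₁ V Φ)).cmType.1) →+* muAlgValueField F (toThm418Data (C F ι₁ V Φ) (R F ι₁ V Φ)).μ,
          (∀ k : reflexField ℚ F (algValuedIn (e F ι₁) (toThm418Data (C F ι₁ V Φ) (R F ι₁ V Φ)).cmType.1),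
            ((incl k : muAlgValueField F (toThm418Data (C F ι₁ V Φ) (R F ι₁ V Φ)).μ) : ℂ) = e F ι₁ k) →
          ∃ (B : AbelianVariety ℂ) (g : (letI := (e F ι₁).toAlgebra; ((R F ι₁ V Φ).Aμ Dμ).baseChange ℂ) ⟶ B), AbelianVariety.IsIsogeny g ∧
            ∃ (ιB : 𝓞 (muAlgValueField F (toThm418Data (C F ι₁ V Φ) (R F ι₁ V Φ)).μ) →+* End B)
              (θB : muAlgValueField F (toThm418Data (C F ι₁ V Φ) (R F ι₁ V Φ)).μ →+* Module.End ℂ (complexBetti B.X 1)),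
              IsCMTypeRealisation (inducedCMType incl (reflexCMType (e F ι₁) (toThm418Data (C F ι₁ V Φ) (R F ι₁ V Φ)).cmType (AlgHom.id ℚ F))) B ιB θB)
    (hUnif : ∀ (F : CMField), IsGalois ℚ F → 6 ≤ Module.finrank ℚ F → ∀ (Φ : CMType F) (ι₁ : F →+* ℂ), ι₁ ∈ Φ.1 →
      ∀ (V : HermSpace3 F ι₁) (τ : maximalRealSubfield F →+* ℝ), C5.IsAbove τ (e F ι₁) →
        ∃ Ksm : Subgroup (P5 F ι₁ V Φ).G, IsOpenCompact Ksm ∧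
          ∀ K : C5.OpenCompactSubgroup (P5 F ι₁ V Φ).G, K.1 ≤ Ksm →
            ∃ (Cset : Type) (_ : Fintype Cset) (X : Cset → SchemeOver ℂ) (B : ∀ c, UnitaryBallUniformisationDatum 2 (X c))
              (Γ : Cset → Level V)
              (inj : ∀ c, X c ⟶ (baseChangeHom (e F ι₁).fieldRange.subtype).obj
                (((P5 F ι₁ V Φ).Sh τ (e F ι₁)).obj (C5.OpenCompactSubgroup.transport ((P5 F ι₁ V Φ).fix τ) K))),
              (∀ c, (B c).Hℂ = V.Hm.map ι₁) ∧
              (∀ c, (B c).Γ.map (Matrix.GeneralLinearGroup.map (B c).τ₁) =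
                (Γ c).Γ.map (Matrix.GeneralLinearGroup.map ι₁)) ∧
              Nonempty (IsColimit (Cofan.mk _ inj)))
    (hAlb : ∀ (F : CMField), IsGalois ℚ F → 6 ≤ Module.finrank ℚ F → ∀ (Φ : CMType F) (ι₁ : F →+* ℂ), ι₁ ∈ Φ.1 →
      ∀ (V : HermSpace3 F ι₁) (K' : C5.SmallLevel (C F ι₁ V Φ).S.K₀) (Cset : Type) (_ : Fintype Cset) (X : Cset → SchemeOver ℂ)
        (inj : ∀ c, X c ⟶ (baseChangeHom (e F ι₁)).obj ((C F ι₁ V Φ).X K')),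
        (∀ c, IsSmoothProjective 2 (X c)) → Nonempty (IsColimit (Cofan.mk _ inj)) →
          ∃ (𝒥 : ∀ c, Jacobian (X c)) (π : ∀ c, (letI := (e F ι₁).toAlgebra; ((C F ι₁ V Φ).A K').baseChange ℂ) ⟶ (𝒥 c).J),
            Nonempty (IsLimit (Fan.mk (letI := (e F ι₁).toAlgebra; ((C F ι₁ V Φ).A K').baseChange ℂ) π))) :
    (picardCMUniverse hHD hI h₁ h₃).FaceSupply :=
  faceSupply_of_thm418AsPrinted_pinned_isog_along hHD hI h₁ h₃
    (fun F ι₁ V Φ => toThm418Data (C F ι₁ V Φ) (R F ι₁ V Φ)) (fun F ι₁ _ _ => e F ι₁)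
    (fun F ι₁ V Φ Dμ => letI := (e F ι₁).toAlgebra; ((R F ι₁ V Φ).Aμ Dμ).baseChange ℂ)
    hLiu hObj hChi hirr hsm hμσ (fun F _ h6 Φ ι₁ hι V Dμ => hCMisogσ F h6 Φ ι₁ hι V Dμ)
    (pinReach_of_componentPinC_of_unif_of_alb_along h₁ h₃ e P5 iso C R hUnif hAlb)

/-! ## §3  THE TEAM-FACING END DISPLAY on the universe of record -/

/-- **END DISPLAY at the APPENDIX-C DATUM along `e ι₁`** (`hU : U = U_rec`, instantiate with `rfl`): `HC_CM` from THE CITE `hLiu`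
([Liu2021] Thm. 4.18 AS PRINTED at `toThm418Data (C …) (R …)`), the printed-elsewhere carriers `hObj`/`hChi`/`hirr`/`hsm`, the choice `hμσ`,
and the READINGS `hCMisogσ` [TEAM hCMisogE], `hTree` + `hAlb` [TEAM hComp] and `hD` [ROW HD] — each to be replaced BY NAME by the teams'
`…Holds` theorems as they land.  Composition: `hc_cm_of_supply_of_dictionary_of_eq _ rfl ∘ exists_supplyWitness_of_faceSupply ∘ §1`.
[GR91 Prop. 3.1.1] does not enter.  HC_CM is NOT proved: `hCMisogσ`, `hTree`, `hAlb`, `hD` are not inhabited here.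
[cite: Liu2021, Thm. 4.18 (FJcycle.tex l. 2232–2245), Def. 4.5 (2) (l. 1944–1951), §4.2 l. 2060–2066 and Prop. C.5 (l. 4627–4637)]
[cite: Deligne1979ShimuraVarieties, §2.1.2] -/
theorem hc_cm_of_thm418AsPrinted_glue_treeCofan_along (U : Universe)
    (hU : U = picardCMUniverse exists_isReal_hodgeModel_holds hodgePQ_independent_of_hodgeModel_holds
      BallQuotient.ballQuotientUniformised_holds cmAbelianVarietyRealised_holds)
    (e : ∀ (F : CMField), (F →+* ℂ) → (F →+* ℂ))
    (P5 : ∀ (F : CMField) (ι₁ : F →+* ℂ) (_ : HermSpace3 F ι₁) (_ : CMType F), PropC5Data (maximalRealSubfield F) F)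
    (iso : ∀ (F : CMField) (ι₁ : F →+* ℂ) (_ : HermSpace3 F ι₁) (_ : CMType F), ℕ → Prop)
    (C : ∀ (F : CMField) (ι₁ : F →+* ℂ) (V : HermSpace3 F ι₁) (Φ : CMType F), Sec42Data (P5 F ι₁ V Φ) (iso F ι₁ V Φ))
    (R : ∀ (F : CMField) (ι₁ : F →+* ℂ) (V : HermSpace3 F ι₁) (Φ : CMType F), Thm418Rest (C F ι₁ V Φ))
    (hLiu : ∀ (F : CMField), IsGalois ℚ F → 6 ≤ Module.finrank ℚ F → ∀ (Φ : CMType F) (ι₁ : F →+* ℂ), ι₁ ∈ Φ.1 →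
      ∀ V : HermSpace3 F ι₁, Thm418AsPrinted (toThm418Data (C F ι₁ V Φ) (R F ι₁ V Φ)))
    (hObj : ∀ (F : CMField), IsGalois ℚ F → 6 ≤ Module.finrank ℚ F → ∀ (Φ : CMType F) (ι₁ : F →+* ℂ), ι₁ ∈ Φ.1 →
      ∀ V : HermSpace3 F ι₁, Nonempty (toThm418Data (C F ι₁ V Φ) (R F ι₁ V Φ)).Obj)
    (hChi : ∀ (F : CMField), IsGalois ℚ F → 6 ≤ Module.finrank ℚ F → ∀ (Φ : CMType F) (ι₁ : F →+* ℂ), ι₁ ∈ Φ.1 →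
      ∀ V : HermSpace3 F ι₁, Nonempty (toThm418Data (C F ι₁ V Φ) (R F ι₁ V Φ)).Chi)
    (hirr : ∀ (F : CMField), IsGalois ℚ F → 6 ≤ Module.finrank ℚ F → ∀ (Φ : CMType F) (ι₁ : F →+* ℂ), ι₁ ∈ Φ.1 →
      ∀ (V : HermSpace3 F ι₁) (i : (toThm418Data (C F ι₁ V Φ) (R F ι₁ V Φ)).AdmIndex), ((toThm418Data (C F ι₁ V Φ) (R F ι₁ V Φ)).rhoAt i).IsIrreducible)
    (hsm : ∀ (F : CMField), IsGalois ℚ F → 6 ≤ Module.finrank ℚ F → ∀ (Φ : CMType F) (ι₁ : F →+* ℂ), ι₁ ∈ Φ.1 →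
      ∀ (V : HermSpace3 F ι₁) (i : (toThm418Data (C F ι₁ V Φ) (R F ι₁ V Φ)).AdmIndex) (v : (toThm418Data (C F ι₁ V Φ) (R F ι₁ V Φ)).omegaAt i),
        ∃ S : Subgroup (toThm418Data (C F ι₁ V Φ) (R F ι₁ V Φ)).G, IsOpen (S : Set (toThm418Data (C F ι₁ V Φ) (R F ι₁ V Φ)).G) ∧ ∀ k ∈ S, (toThm418Data (C F ι₁ V Φ) (R F ι₁ V Φ)).rhoAt i k v = v)
    (hμσ : ∀ (F : CMField), IsGalois ℚ F → 6 ≤ Module.finrank ℚ F → ∀ (Φ : CMType F) (ι₁ : F →+* ℂ), ι₁ ∈ Φ.1 →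
      ∀ (V : HermSpace3 F ι₁) (g : F ≃ₐ[ℚ] F),
        (e F ι₁).comp (g : F →+* F) ∈ (toThm418Data (C F ι₁ V Φ) (R F ι₁ V Φ)).cmType.1 ↔ (e F ι₁).comp (g.symm : F →+* F) ∈ Φ.1)
    (hCMisogσ : ∀ (F : CMField) [IsGalois ℚ F], 6 ≤ Module.finrank ℚ F → ∀ (Φ : CMType F) (ι₁ : F →+* ℂ), ι₁ ∈ Φ.1 →
      ∀ (V : HermSpace3 F ι₁) (Dμ : (toThm418Data (C F ι₁ V Φ) (R F ι₁ V Φ)).Obj),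
        haveI := (toThm418Data (C F ι₁ V Φ) (R F ι₁ V Φ)).isConjugateSymplectic.numberField_muAlgValueField
        ∀ incl : reflexField ℚ F (algValuedIn (e F ι₁) (toThm418Data (C F ι₁ V Φ) (R F ι₁ V Φ)).cmType.1) →+* muAlgValueField F (toThm418Data (C F ι₁ V Φ) (R F ι₁ V Φ)).μ,
          (∀ k : reflexField ℚ F (algValuedIn (e F ι₁) (toThm418Data (C F ι₁ V Φ) (R F ι₁ V Φ)).cmType.1),
            ((incl k : muAlgValueField F (toThm418Data (C F ι₁ V Φ) (R F ι₁ V Φ)).μ) : ℂ) = e F ι₁ k) →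
          ∃ (B : AbelianVariety ℂ) (g : (letI := (e F ι₁).toAlgebra; ((R F ι₁ V Φ).Aμ Dμ).baseChange ℂ) ⟶ B), AbelianVariety.IsIsogeny g ∧
            ∃ (ιB : 𝓞 (muAlgValueField F (toThm418Data (C F ι₁ V Φ) (R F ι₁ V Φ)).μ) →+* End B)
              (θB : muAlgValueField F (toThm418Data (C F ι₁ V Φ) (R F ι₁ V Φ)).μ →+* Module.End ℂ (complexBetti B.X 1)),
              IsCMTypeRealisation (inducedCMType incl (reflexCMType (e F ι₁) (toThm418Data (C F ι₁ V Φ) (R F ι₁ V Φ)).cmType (AlgHom.id ℚ F))) B ιB θB)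
    (hTree : ∀ (F : CMField), IsGalois ℚ F → 6 ≤ Module.finrank ℚ F → ∀ (Φ : CMType F) (ι₁ : F →+* ℂ), ι₁ ∈ Φ.1 →
      ∀ (V : HermSpace3 F ι₁) (τ : maximalRealSubfield F →+* ℝ), C5.IsAbove τ (e F ι₁) →
        ∃ Ksm : Subgroup (P5 F ι₁ V Φ).G, IsOpenCompact Ksm ∧
          ∀ K : C5.OpenCompactSubgroup (P5 F ι₁ V Φ).G, K.1 ≤ Ksm →
            ∃ (Cset : Type) (_ : Fintype Cset) (Γ : Cset → Level V)
              (inj : ∀ c, Var.scheme (ballQuotientUniformisedDatum_of BallQuotient.ballQuotientUniformised_holds)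
                cmAbelianVarietyRealised_holds (.pms (pmsCode F ι₁ V (Γ c))) ⟶
                (baseChangeHom (e F ι₁).fieldRange.subtype).obj
                  (((P5 F ι₁ V Φ).Sh τ (e F ι₁)).obj (C5.OpenCompactSubgroup.transport ((P5 F ι₁ V Φ).fix τ) K))),
              Nonempty (IsColimit (Cofan.mk _ inj)))
    (hAlb : ∀ (F : CMField), IsGalois ℚ F → 6 ≤ Module.finrank ℚ F → ∀ (Φ : CMType F) (ι₁ : F →+* ℂ), ι₁ ∈ Φ.1 →
      ∀ (V : HermSpace3 F ι₁) (K' : C5.SmallLevel (C F ι₁ V Φ).S.K₀) (Cset : Type) (_ : Fintype Cset) (X : Cset → SchemeOver ℂ)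
        (inj : ∀ c, X c ⟶ (baseChangeHom (e F ι₁)).obj ((C F ι₁ V Φ).X K')),
        (∀ c, IsSmoothProjective 2 (X c)) → Nonempty (IsColimit (Cofan.mk _ inj)) →
          ∃ (𝒥 : ∀ c, Jacobian (X c)) (π : ∀ c, (letI := (e F ι₁).toAlgebra; ((C F ι₁ V Φ).A K').baseChange ℂ) ⟶ (𝒥 c).J),
            Nonempty (IsLimit (Fan.mk (letI := (e F ι₁).toAlgebra; ((C F ι₁ V Φ).A K').baseChange ℂ) π)))
    (hD : ∀ (F : CMField), IsGalois ℚ F → 6 ≤ Module.finrank ℚ F → ∀ (f : Face F) (ι₁ : F →+* ℂ), f.Admissible ι₁ →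
      ∀ V : HermSpace3 F ι₁,
        ∃ (HG : Type) (_ : NormedAddCommGroup HG) (_ : InnerProductSpace ℂ HG)
          (emb : ∀ Γ : Level V, U.CohC (U.pms F ι₁ V Γ) 2 →ₗ[ℂ] HG)
          (cover : ∀ (Γ Γ' : Level V), Γ' ≤ Γ → U.Mor (U.pms F ι₁ V Γ') (U.pms F ι₁ V Γ)),
          (∀ (Γ : Level V) (ω₁ ω₂ : U.CohC (U.pms F ι₁ V Γ) 1), ω₁ ∈ U.Uiso Γ F (f.psi 0) ι₁ → ω₂ ∈ U.Uiso Γ F (f.psi 1) ι₁ →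
            emb Γ (U.cup2C (U.pms F ι₁ V Γ) 1 ω₁ ω₂) ∈ (Submodule.span ℂ
              {x : HG | ∃ (Γ' : Level V), ∃ ω₃ ∈ U.Uiso Γ' F (f.psi 2) ι₁, ∃ ω₄ ∈ U.Uiso Γ' F (f.psi 3) ι₁,
                x = emb Γ' (U.cup2C (U.pms F ι₁ V Γ') 1 ω₃ ω₄)}).topologicalClosure) ∧
          (∀ (Γ Γ' : Level V) (hle : Γ' ≤ Γ) (x : U.CohC (U.pms F ι₁ V Γ) 2),
            emb Γ' (U.pullC (cover Γ Γ' hle) 2 x) = emb Γ x) ∧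
          (∀ Γ : Level V, ∃ c : ℂ, c ≠ 0 ∧ ∀ x y : U.CohC (U.pms F ι₁ V Γ) 2,
            x ∈ (U.hodge (U.pms F ι₁ V Γ) 2).F 2 → y ∈ (U.hodge (U.pms F ι₁ V Γ) 2).F 2 →
              ⟪emb Γ y, emb Γ x⟫_ℂ = c * U.trC (U.pms F ι₁ V Γ) 4 (U.cup2C (U.pms F ι₁ V Γ) 2 x (conj y)))) :
    HC_CM := by
  subst hU
  exact hc_cm_of_supply_of_dictionary_of_eq _ rfl
    (exists_supplyWitness_of_faceSupply _ _ _ _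
      (faceSupply_of_thm418AsPrinted_glue_treeCofan_along _ _ _ _ e P5 iso C R hLiu hObj hChi hirr hsm hμσ hCMisogσ hTree hAlb)) hD

end Summit.HodgeConjecture.CorCM.Model

end
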